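import Literature.MathematicalPhysics.QuantumFieldTheory.Balaban1983to89.B5G183CovSplit
import Literature.MathematicalPhysics.QuantumFieldTheory.Balaban1983to89.B5Hk163Decay

/-!
# `Balaban1983to89.B5G183CovDecay` — STRIP REGULARITY and EXPONENTIAL KERNEL DECAY of the fine-offset multipliers of the COVARIANT REGULAR PART of the continued (1.83) entry symbol of `G = Δ₁⁻¹`, uniformly in `n` (cell node X9; the (1.83) analogue of `B5Hk163Decay`)

T. Bałaban, *Propagators and renormalization transformations for lattice gauge theories. I*, Commun. Math.
Phys. **95**, 17–40 (1984) [`Balaban1984PropagatorsI`, cell paper B5], (1.83)–(1.84) p. 31 [PDF 15], text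
p. 32–33 [PDF 16–17]; p. 38 [PDF 22] (the «analyticity method» pointer to the proof of Lemma 2.4 of
[`Balaban1983RegularityDecay`], CMP 89, p. 582–583).  LOCATIONS only: NOTHING printed in B5 or B4 is a hypothesis,
a quotation or a `[cite:]`-tagged statement of this file; every declaration is `[folklore]` analysis about the
tree's own objects, kernel-checked from the imported tree modules.  No `axiom`, no `sorry`.

## What this file does

`B5G183CovSplit` (this lineage) split the regrouped holomorphic continuation `g183` of the (1.83) entry symbol as
`g = freeN N + g183cov N`, `freeN = δ_{μν}δ_{ll′}Σ_{j<N}(Δ(p′+l)+1)^{−(j+1)}` (explicit powers of the unit-mass free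
`η`-lattice propagator) and proved for the COVARIANT REGULAR PART `g183cov N`: holomorphy on the zero-free strip,
the `n`-UNIFORM double alias bound `Σ_{l,l′}‖g^{cov,N}‖ ≤ Mcov183 d N` (`N + 1 ≥ d`) and the side covariance
`g^{cov,N}(l,l′;p′+2πe_i) = g^{cov,N}(σ_i l,σ_i l′;p′)`.  Here these three inputs are packaged — exactly as
`B5Hk163Decay` packages (1.63) — into the lineage's contour-shift interface `B4ContourShift.StripRegular` and the
kernel decay is read off BY NAME:
* §1 `phaseNeg n l′ b p′ := Π_ν (e^{−iη(p′_ν+l′_ν)})^{b_ν}` — the right (conjugate) fine-offset phase; modulus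
  `≤ (e^κ)^d` on the strip (`norm_phaseNeg_le`), entire (`differentiable_phaseNeg`), alias-covariant
  (`phaseNeg_tr`, from `B5Hk163Decay.exp_shift_tr`).  The left phase is `B5Hk163Decay.phase163`.
* §2 **`Mcov n N μ ν a b p′ := Σ_{l,l′} phase163(l,a,p′)·g^{cov,N}_{μν}(l,l′;p′)·phaseNeg(l′,b,p′)`** — the
  fine-offset multiplier of the covariant regular part (fine points `x = y + ηa`, `x′ = y′ + ηb`);
  **`Mcov_tr`**: `M(p′+2πe_i) = M(p′)` at every side point `Re p′_i = −π` of the zero-free strip (summands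
  `σ_i`-covariant, `σ_i × σ_i` a bijection of the index set); **`norm_Mcov_le`**: `‖M(p′)‖ ≤ (e^κ)^d(e^κ)^d·Mcov183 d N`
  UNIFORMLY IN `n`, `a`, `b` (`N + 1 ≥ d`); `differentiableAt_Mcov`: joint holomorphy.
* §3 **`stripRegular_Mcov`**: in dimension `d + 1`, for every `n ≥ 1`, `μ ν a b`, `N ≥ d`, `0 ≤ κ ≤ κ₁₈₃(d+1)`:
  `StripRegular (fun p => Mcov n N μ ν a b p) κ (MD183 (d+1) N)`, `MD183 d N := (e¹)^d(e¹)^d·Mcov183 d N`; hence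
  **`latticeKernel_Mcov_decay`**: `‖K(x)‖ ≤ MD183(d+1,N)·e^{−κ₁₈₃(d+1)|x|_∞}` on `ℤ^{d+1}`
  (`B4ContourShift.latticeKernel_decay`) and **`torusKernel_Mcov_decay`** (every period vector;
  `B4TorusKernel.MultiPeriod.torusKernel_descend_decay_torusMetric`) — the rate `κ₁₈₃(d+1)` and the constant are
  INDEPENDENT OF `n`, of the fine offsets and of the periods.

## HONEST SCOPE

(i) What decays here is the COARSE-LATTICE kernel (Fourier coefficients in `p′` over `ℤ^{d+1}`, resp. the torus)
of the multiplier of the covariant REGULAR PART, per pair of fine offsets `(a, b)` and per `(μ, ν)`; the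
identification of `Σ_{a,b}`-blocks with the kernel `G(1)(x,x′)` of (1.83) on the fine lattice (fine point = coarse
point + offset, `B5Hk163Decay.exp_fine_phase_split` for the left phase and its conjugate for the right one) and the
re-addition of the FREE part `δ_{μν}Σ_{j<N}(−Δ^η+1)^{−(j+1)}(x,x′)` — explicit powers of the massive free
propagator, whose kernels decay classically at the unit-mass rate on the `η`-lattice, NOT typed in this lineage —
are the consumer's bookkeeping (t4-ne2-p2, cell GAPS row G-ne2p2-9 (β)).  (ii) `U = 1`, `a = 1` (lattice
spacing), `n ≥ 1` arbitrary, as in the whole b05/pv15 lineage; general `U` needs the covariant-symbol layer nobody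
has typed.  (iii) CONSTANTS crude; the decay RATE is the lineage's strip half-width `κ₁₈₃(d+1)` of `B5G183Strip`
(far from B5's `δ₀`); only uniformity in `n`, offsets, periods is content.  (iv) This is NOT Bałaban's proof of
Proposition 1.2 / (1.90) (he applies the «analyticity method» to `𝒟(p′)⁻¹` after the operator identity (1.88));
it is the lineage's symbol-level route, recorded as such; no claim about print.  Value = kernel certificate
(the (1.83) regular-part decay layer of X9 modulo the free part and the fine/coarse dictionary), NOT summit
progress.  Unit `b2b-balaban-pv15-g10` (PV15 cell lineage, generation 10; author of `B5G183Strip`, `B5G183Alias`,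
`B5G183AliasSum`, `B5G183CovSplit`).
-/

open scoped BigOperators Real
open Finset Complex

namespace Literature.MathematicalPhysics.QuantumFieldTheory.Balaban1983to89.B5G183CovDecay

open Literature.MathematicalPhysics.QuantumFieldTheory.Balaban1983to89.B4Strip
open Literature.MathematicalPhysics.QuantumFieldTheory.Balaban1983to89.B4StripCauchy
open Literature.MathematicalPhysics.QuantumFieldTheory.Balaban1983to89.B4ContourShift
open Literature.MathematicalPhysics.QuantumFieldTheory.Balaban1983to89.B4TorusKernel (descendC periodConst)
open Literature.MathematicalPhysics.QuantumFieldTheory.Balaban1983to89.B4TorusKernel.MultiPeriod (torusKernel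
  torusSupNorm torusKernel_descend_decay_torusMetric)
open Literature.MathematicalPhysics.QuantumFieldTheory.Balaban1983to89.B5Strip145
open Literature.MathematicalPhysics.QuantumFieldTheory.Balaban1983to89.B5Strip145Analytic
open Literature.MathematicalPhysics.QuantumFieldTheory.Balaban1983to89.B5Strip145Decay (differentiableAt_insertNth
  tr_insertNth_left insertNth_left_mem)
open Literature.MathematicalPhysics.QuantumFieldTheory.Balaban1983to89.B5Hk163Strip (differentiable_shiftPhase
  shift_im)
open Literature.MathematicalPhysics.QuantumFieldTheory.Balaban1983to89.B5Hk163Decay (phase163 norm_phase163_le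
  differentiable_phase163 phase163_tr norm_exp_shift_pow_le exp_shift_tr)
open Literature.MathematicalPhysics.QuantumFieldTheory.Balaban1983to89.B5G183Strip
open Literature.MathematicalPhysics.QuantumFieldTheory.Balaban1983to89.B5G183Alias
open Literature.MathematicalPhysics.QuantumFieldTheory.Balaban1983to89.B5G183AliasSum
open Literature.MathematicalPhysics.QuantumFieldTheory.Balaban1983to89.B5G183CovSplit

variable {d : ℕ}

/-! ## §1. The conjugate fine-offset phase `e^{−i(p′+l′)·ηb}` -/

section Phase

variable (n : ℕ) [NeZero n]

/-- the RIGHT (conjugate) fine-offset phase `e^{−i(p′+l′)·ηb} = Π_ν (e^{−iη(p′_ν+l′_ν)})^{b_ν}`, `l′ = 2πk′`,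
`b ∈ {0,…,n−1}^d`, `η = 1/n`. [folklore] -/
noncomputable def phaseNeg (k b : Fin d → Fin n) (p : Fin d → ℂ) : ℂ :=
  ∏ ν, Complex.exp (-(shift n k p ν / n * I)) ^ (b ν : ℕ)

/-- one conjugate phase factor has modulus `e^{+Im p′_ν·b_ν/n} ≤ e^κ` on the strip (`b_ν < n`). [folklore] -/
theorem norm_exp_neg_shift_pow_le {κ : ℝ} {p : Fin d → ℂ} (hp : p ∈ Strip d κ) (k : Fin d → Fin n) (ν : Fin d)
    (b : Fin n) : ‖Complex.exp (-(shift n k p ν / n * I)) ^ (b : ℕ)‖ ≤ Real.exp κ := by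
  have hn : (0 : ℝ) < n := Nat.cast_pos.mpr (Nat.pos_of_ne_zero (NeZero.ne n))
  have him : |(p ν).im| ≤ κ := (hp ν).2
  rw [norm_pow, Complex.norm_exp, ← Real.exp_nat_mul]
  apply Real.exp_le_exp.mpr
  have hre : (-(shift n k p ν / n * I)).re = (p ν).im / n := by
    rw [Complex.neg_re, Complex.mul_I_re, Complex.div_natCast_im, shift_im]; ring
  rw [hre]
  have hb : ((b : ℕ) : ℝ) / n ≤ 1 := by
    rw [div_le_one hn]; exact_mod_cast b.isLt.le
  have hb0 : 0 ≤ ((b : ℕ) : ℝ) / n := by positivity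
  calc ((b : ℕ) : ℝ) * ((p ν).im / n) = (((b : ℕ) : ℝ) / n) * (p ν).im := by ring
    _ ≤ (((b : ℕ) : ℝ) / n) * |(p ν).im| := by gcongr; exact le_abs_self _
    _ ≤ 1 * κ := mul_le_mul hb him (abs_nonneg _) zero_le_one
    _ = κ := one_mul κ

/-- `‖phaseNeg l′ b p′‖ ≤ (e^κ)^d` on the strip. [folklore] -/
theorem norm_phaseNeg_le {κ : ℝ} {p : Fin d → ℂ} (hp : p ∈ Strip d κ) (k b : Fin d → Fin n) :
    ‖phaseNeg n k b p‖ ≤ Real.exp κ ^ d := by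
  unfold phaseNeg
  rw [norm_prod]
  calc ∏ ν, ‖Complex.exp (-(shift n k p ν / n * I)) ^ (b ν : ℕ)‖ ≤ ∏ _ν : Fin d, Real.exp κ :=
        Finset.prod_le_prod (fun ν _ => norm_nonneg _) (fun ν _ => norm_exp_neg_shift_pow_le n hp k ν (b ν))
    _ = Real.exp κ ^ d := by rw [Finset.prod_const, Finset.card_univ, Fintype.card_fin]

omit [NeZero n] in
/-- the conjugate phase is entire. [folklore] -/
theorem differentiable_phaseNeg (k b : Fin d → Fin n) :
    Differentiable ℂ (fun p : Fin d → ℂ => phaseNeg n k b p) := by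
  intro q
  unfold phaseNeg
  exact dAt_finset_prod _ _ q (fun ν _ => ((differentiable_shiftPhase n k ν) q).neg.cexp.pow _)

/-- the conjugate coordinate phase factor is ALIAS-COVARIANT. [folklore] -/
theorem exp_neg_shift_tr (k : Fin d → Fin n) (p : Fin d → ℂ) (ν μ : Fin d) :
    Complex.exp (-(shift n k (tr p ν) μ / n * I)) = Complex.exp (-(shift n (sigma n ν k) p μ / n * I)) := by
  rw [Complex.exp_neg, Complex.exp_neg, exp_shift_tr]

/-- `phaseNeg l′ b (p′ + 2πe_ν) = phaseNeg (σ_ν l′) b p′`. [folklore] -/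
theorem phaseNeg_tr (k b : Fin d → Fin n) (p : Fin d → ℂ) (ν : Fin d) :
    phaseNeg n k b (tr p ν) = phaseNeg n (sigma n ν k) b p := by
  unfold phaseNeg
  exact Finset.prod_congr rfl (fun μ _ => by rw [exp_neg_shift_tr])

end Phase

/-! ## §2. The fine-offset multiplier of the covariant regular part: side periodicity, bound, holomorphy -/

section Mult

variable (n : ℕ) [NeZero n]

/-- THE FINE-OFFSET MULTIPLIER of the covariant regular part of (1.83):
`M^{cov,N}_{ab;μν}(p′) := Σ_{l,l′ ∈ 2π{0,…,n−1}^d} e^{i(p′+l)·ηa} g^{cov,N}_{μν}(l,l′;p′) e^{−i(p′+l′)·ηb}`. [folklore] -/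
noncomputable def Mcov (N : ℕ) (μ ν : Fin d) (a b : Fin d → Fin n) (p : Fin d → ℂ) : ℂ :=
  ∑ k : Fin d → Fin n, ∑ k' : Fin d → Fin n, phase163 n k a p * g183cov n N μ ν k k' p * phaseNeg n k' b p

/-- **SIDE PERIODICITY**: at a side point `Re p′_i = −π` of the zero-free strip,
`M^{cov,N}_{ab;μν}(p′ + 2πe_i) = M^{cov,N}_{ab;μν}(p′)` — every summand is `σ_i`-covariant (`phase163_tr`,
`B5G183CovSplit.g183cov_tr`, `phaseNeg_tr`) and `σ_i × σ_i` permutes the index set. [folklore] -/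
theorem Mcov_tr {κ : ℝ} (hκ0 : 0 ≤ κ) (hκ : κ ≤ kappa183 d) {p : Fin d → ℂ} (hp : p ∈ Strip d κ) (i : Fin d)
    (hre : (p i).re = -Real.pi) (N : ℕ) (μ ν : Fin d) (a b : Fin d → Fin n) :
    Mcov n N μ ν a b (tr p i) = Mcov n N μ ν a b p := by
  unfold Mcov
  have h : ∀ k k' : Fin d → Fin n,
      phase163 n k a (tr p i) * g183cov n N μ ν k k' (tr p i) * phaseNeg n k' b (tr p i) =
      phase163 n (sigma n i k) a p * g183cov n N μ ν (sigma n i k) (sigma n i k') p * phaseNeg n (sigma n i k') b p :=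
    fun k k' => by rw [phase163_tr, g183cov_tr n hκ0 hκ hp i hre N μ ν k k', phaseNeg_tr]
  simp_rw [h]
  have h1 : ∑ k : Fin d → Fin n, ∑ k' : Fin d → Fin n,
      phase163 n (sigma n i k) a p * g183cov n N μ ν (sigma n i k) (sigma n i k') p * phaseNeg n (sigma n i k') b p
      = ∑ k : Fin d → Fin n, ∑ k' : Fin d → Fin n,
      phase163 n k a p * g183cov n N μ ν k (sigma n i k') p * phaseNeg n (sigma n i k') b p :=
    Equiv.sum_comp (sigmaEquiv n i) (fun k => ∑ k' : Fin d → Fin n,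
      phase163 n k a p * g183cov n N μ ν k (sigma n i k') p * phaseNeg n (sigma n i k') b p)
  rw [h1]
  exact Finset.sum_congr rfl (fun k _ =>
    Equiv.sum_comp (sigmaEquiv n i) (fun k' => phase163 n k a p * g183cov n N μ ν k k' p * phaseNeg n k' b p))

/-- **THE STRIP BOUND** `‖M^{cov,N}_{ab;μν}(p′)‖ ≤ (e^κ)^d·(e^κ)^d·Mcov183 d N`, uniformly in `n`, `a`, `b`, for
`N + 1 ≥ d`. [folklore] -/
theorem norm_Mcov_le {κ : ℝ} (hκ0 : 0 ≤ κ) (hκ : κ ≤ kappa183 d) {p : Fin d → ℂ} (hp : p ∈ Strip d κ)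
    {N : ℕ} (hN : d ≤ N + 1) (μ ν : Fin d) (a b : Fin d → Fin n) :
    ‖Mcov n N μ ν a b p‖ ≤ Real.exp κ ^ d * Real.exp κ ^ d * Mcov183 d N := by
  unfold Mcov
  have hE : 0 ≤ Real.exp κ ^ d := by positivity
  calc ‖∑ k : Fin d → Fin n, ∑ k' : Fin d → Fin n, phase163 n k a p * g183cov n N μ ν k k' p * phaseNeg n k' b p‖
      ≤ ∑ k : Fin d → Fin n, ‖∑ k' : Fin d → Fin n, phase163 n k a p * g183cov n N μ ν k k' p * phaseNeg n k' b p‖ :=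
        norm_sum_le _ _
    _ ≤ ∑ k : Fin d → Fin n, ∑ k' : Fin d → Fin n, ‖phase163 n k a p * g183cov n N μ ν k k' p * phaseNeg n k' b p‖ :=
        Finset.sum_le_sum (fun k _ => norm_sum_le _ _)
    _ ≤ ∑ k : Fin d → Fin n, ∑ k' : Fin d → Fin n,
          (Real.exp κ ^ d * Real.exp κ ^ d) * ‖g183cov n N μ ν k k' p‖ := by
        refine Finset.sum_le_sum (fun k _ => Finset.sum_le_sum (fun k' _ => ?_))
        rw [norm_mul, norm_mul]
        have h1 := norm_phase163_le n hp k a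
        have h2 := norm_phaseNeg_le n hp k' b
        have hg := norm_nonneg (g183cov n N μ ν k k' p)
        calc ‖phase163 n k a p‖ * ‖g183cov n N μ ν k k' p‖ * ‖phaseNeg n k' b p‖
            ≤ Real.exp κ ^ d * ‖g183cov n N μ ν k k' p‖ * Real.exp κ ^ d :=
              mul_le_mul (mul_le_mul_of_nonneg_right h1 hg) h2 (norm_nonneg _) (mul_nonneg hE hg)
          _ = (Real.exp κ ^ d * Real.exp κ ^ d) * ‖g183cov n N μ ν k k' p‖ := by ring
    _ = (Real.exp κ ^ d * Real.exp κ ^ d) *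
          ∑ k : Fin d → Fin n, ∑ k' : Fin d → Fin n, ‖g183cov n N μ ν k k' p‖ := by
        rw [Finset.mul_sum]
        exact Finset.sum_congr rfl (fun k _ => by rw [Finset.mul_sum])
    _ ≤ Real.exp κ ^ d * Real.exp κ ^ d * Mcov183 d N :=
        mul_le_mul_of_nonneg_left (sum_norm_g183cov_le n hκ0 hκ hp hN μ ν) (mul_nonneg hE hE)

/-- **HOLOMORPHY**: `M^{cov,N}_{ab;μν}` is (jointly) holomorphic at every point of the zero-free strip. [folklore] -/
theorem differentiableAt_Mcov {κ : ℝ} (hκ0 : 0 ≤ κ) (hκ : κ ≤ kappa183 d) {p : Fin d → ℂ}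
    (hp : p ∈ Strip d κ) (N : ℕ) (μ ν : Fin d) (a b : Fin d → Fin n) :
    DifferentiableAt ℂ (fun q : Fin d → ℂ => Mcov n N μ ν a b q) p := by
  unfold Mcov
  exact DifferentiableAt.fun_sum (fun k _ => DifferentiableAt.fun_sum (fun k' _ =>
    (((differentiable_phase163 n k a) p).mul (differentiableAt_g183cov n hκ0 hκ hp N μ ν k k')).mul
      ((differentiable_phaseNeg n k' b) p)))

end Mult

/-! ## §3. Strip regularity (dimension `d + 1`) and the kernel decay corollaries -/

section Regular

/-- the explicit `d, N`-only strip bound `(e¹)^d (e¹)^d · Mcov183 d N` (uses `κ ≤ κ₁₈₃ ≤ 1`). [folklore] -/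
noncomputable def MD183 (d N : ℕ) : ℝ := Real.exp 1 ^ d * Real.exp 1 ^ d * Mcov183 d N

/-- `0 ≤ MD183`. [folklore] -/
theorem MD183_nonneg (d N : ℕ) : 0 ≤ MD183 d N := by
  unfold MD183; have := Mcov183_nonneg d N; positivity

/-- **STRIP REGULARITY OF THE FINE-OFFSET MULTIPLIERS OF THE COVARIANT REGULAR PART** on `ℂ^{d+1}`: for EVERY
`n ≥ 1`, `μ`, `ν`, fine offsets `a`, `b`, every `N` with `N + 1 ≥ d + 1` and `0 ≤ κ ≤ κ₁₈₃(d+1)`,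
`Mcov n N μ ν a b` is continuous on the closed strip, holomorphic in every coordinate slice, takes equal values on
the vertical sides, and is bounded by `MD183 (d+1) N` — uniformly in `n`. [folklore] -/
theorem stripRegular_Mcov (n : ℕ) [NeZero n] {κ : ℝ} (hκ0 : 0 ≤ κ) (hκ : κ ≤ kappa183 (d + 1))
    {N : ℕ} (hN : d + 1 ≤ N + 1) (μ ν : Fin (d + 1)) (a b : Fin (d + 1) → Fin n) :
    StripRegular (d := d) (fun p : Fin (d + 1) → ℂ => Mcov n N μ ν a b p) κ (MD183 (d + 1) N) := by
  have hκ1 : κ ≤ 1 := (kappa_small hκ0 (hκ.trans (kappa183_le_rOf _))).1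
  have hdiffAt : ∀ p ∈ Strip (d + 1) κ, DifferentiableAt ℂ (fun q : Fin (d + 1) → ℂ => Mcov n N μ ν a b q) p :=
    fun p hp => differentiableAt_Mcov n hκ0 hκ hp N μ ν a b
  refine ⟨?_, ?_, ?_, ?_⟩
  · exact fun p hp => (hdiffAt p hp).continuousAt.continuousWithinAt
  · intro i q hq z hz
    have hP : i.insertNth z (ofRealVec q) ∈ Strip (d + 1) κ :=
      insertNth_mem_Strip hκ0 i hq (openRect_subset_closedRect κ hz)
    exact ((hdiffAt _ hP).comp z (differentiableAt_insertNth i _ z)).differentiableWithinAt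
  · intro i q hq y hy
    obtain ⟨hP, hre⟩ := insertNth_left_mem hκ0 i hq hy
    show Mcov n N μ ν a b _ = Mcov n N μ ν a b _
    rw [← tr_insertNth_left]
    exact (Mcov_tr n hκ0 hκ hP i hre N μ ν a b).symm
  · intro p hp
    refine (norm_Mcov_le n hκ0 hκ hp hN μ ν a b).trans ?_
    unfold MD183
    have hM := Mcov183_nonneg (d + 1) N
    have he : Real.exp κ ^ (d + 1) ≤ Real.exp 1 ^ (d + 1) :=
      pow_le_pow_left₀ (Real.exp_pos κ).le (Real.exp_le_exp.mpr hκ1) _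
    have he0 : 0 ≤ Real.exp κ ^ (d + 1) := by positivity
    exact mul_le_mul_of_nonneg_right (mul_le_mul he he he0 (by positivity)) hM

/-- **EXPONENTIAL DECAY OF THE INFINITE-LATTICE KERNEL** of `M^{cov,N}_{ab;μν}` (`B4ContourShift.latticeKernel_decay`
by name): `‖K(x)‖ ≤ MD183(d+1,N) · e^{−κ₁₈₃(d+1)·|x|_∞}` for every `x ∈ ℤ^{d+1}`, `n ≥ 1`, `μ ν a b`, `N ≥ d`.
[folklore] -/
theorem latticeKernel_Mcov_decay (n : ℕ) [NeZero n] {N : ℕ} (hN : d + 1 ≤ N + 1) (μ ν : Fin (d + 1))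
    (a b : Fin (d + 1) → Fin n) (x : Fin (d + 1) → ℤ) :
    ‖latticeKernel (fun p : Fin (d + 1) → ℂ => Mcov n N μ ν a b p) x‖ ≤
      MD183 (d + 1) N * Real.exp (-(kappa183 (d + 1) * supNorm x)) :=
  latticeKernel_decay (stripRegular_Mcov n (kappa183_pos _).le le_rfl hN μ ν a b) (kappa183_pos _).le x

/-- **EXPONENTIAL DECAY OF THE TORUS KERNELS** of `M^{cov,N}_{ab;μν}`
(`B4TorusKernel.MultiPeriod.torusKernel_descend_decay_torusMetric` by name): for every period vector (all `≥ 1`),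
`n ≥ 1`, `μ ν a b`, `N ≥ d`, `x`. [folklore] -/
theorem torusKernel_Mcov_decay (n : ℕ) [NeZero n] {N : ℕ} (hN : d + 1 ≤ N + 1) (μ ν : Fin (d + 1))
    (a b : Fin (d + 1) → Fin n) {P : Fin (d + 1) → ℕ} (hP : ∀ i, 1 ≤ P i) (x : Fin (d + 1) → ℤ) :
    ‖torusKernel (descendC (fun p : Fin (d + 1) → ℂ => Mcov n N μ ν a b p)
        (stripRegular_Mcov n (kappa183_pos _).le le_rfl hN μ ν a b) (kappa183_pos _).le) P x‖ ≤
      MD183 (d + 1) N * periodConst (kappa183 (d + 1)) d *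
        Real.exp (-(kappa183 (d + 1) / (d + 1) * torusSupNorm P x)) :=
  torusKernel_descend_decay_torusMetric _ (kappa183_pos _) hP x

end Regular

end Literature.MathematicalPhysics.QuantumFieldTheory.Balaban1983to89.B5G183CovDecay
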